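import Summits.Ventures.LatticeQCDFlow.Exactness.ReversibleLocalityFloor
import HarnessLib

/-!
# A sticky set kills the spectral gap: `ρ_{1_A}(1) ≥ 1 − ε/(1 − π(A))` for EVERY reversible sampler

HONEST FRAMING: exact (Metropolis-corrected) sampling algorithms for lattice gauge theory;
figures of merit are autocorrelation/cost numbers at stated couplings and volumes; no
continuum-physics claim.  (SCALAR calibration rung S0-A: not a gauge result.)

Venture `LatticeQCDFlow` (cell pub-lqcd), topic `Exactness`; FANOUT row 2 (`s0-phi4`).  NEW WORK of
the cell in the abstract `RevOp` format of `Exactness/ReversibleLocalityFloor.lean` (a Markov operator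
`K` on an admissible class `A` of observables, reversible w.r.t. the weight `w`, `K1 = 1`): the
operator algebra behind `Exactness/Phi4HMCNoSpectralGap.lean`, stated once for every arm and every
row (local Metropolis, flow sampler, φ⁴ / gauge HMC in this format).  Nothing is cited as a fact; the
rejection-probability criterion for the failure of geometric ergodicity is Roberts–Tweedie 1996
(Biometrika 83, Thm 5.1), NAMED ONLY.

## What is proved (namespace `RevOp`; `χ ∈ A` with values in `{0, 1}`, `a Z = ∫ χ w`, `g = χ − c`)

* `indicator_var_eq` — `∫ (χ − a)² w = (1 − a) ∫ χ w` when `a ∫ w = ∫ χ w`;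
* **`dirichlet_indicator_eq`** — `∫ g² w − ∫ g (K g) w = ∫ χ · K[1 − χ] · w` (linearity, `K1 = 1`,
  reversibility against `1`);
* **`dirichlet_indicator_le_of_sticky`** — if from every state with `χ = 1` the set is LEFT with
  probability at most `ε` (`K[1 − χ] ≤ ε` on `{χ = 1}`), then `∫ g² w − ∫ g (K g) w ≤ ε ∫ χ w`;
* **`autocorr_ge_of_sticky`** — hence, with `0 < ∫ χ w`, `a ∫ w = ∫ χ w` and `a ≤ ½`:
  `ρ_{χ − a}(1) = ∫ g (Kg) w / ∫ g² w ≥ 1 − 2ε` — a family of sticky sets with `ε → 0` rules out a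
  spectral gap for any reversible exact sampler, whatever the arm.

NOT CLAIMED: anything about a specific sampler (instances: `Phi4HMCNoSpectralGap*`); the converse.
-/

namespace Summit.Ventures.LatticeQCDFlow.Exactness

open Real MeasureTheory Filter Finset
open Summit.Ventures.LatticeQCDFlow.Scoring

namespace RevOp

variable {X : Type*} [MeasurableSpace X] {μ : Measure X} {w : X → ℝ} {A : (X → ℝ) → Prop}
  {K : (X → ℝ) → (X → ℝ)}

omit [MeasurableSpace X] in
/-- Shifting an admissible observable by a constant keeps it admissible. -/
theorem sub_const_mem (hA1 : A (fun _ => (1 : ℝ)))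
    (hAc : ∀ ⦃f h : X → ℝ⦄ (c : ℝ), A f → A h → A (fun x => f x + c * h x))
    {χ : X → ℝ} (hχ : A χ) (c : ℝ) : A (fun x => χ x - c) := by
  have h := hAc (-c) hχ hA1
  have e : (fun x => χ x + -c * (1 : ℝ)) = fun x => χ x - c := by funext x; ring
  rw [e] at h
  exact h

omit [MeasurableSpace X] in
/-- `1 − χ` is admissible. -/
theorem one_sub_mem (hA1 : A (fun _ => (1 : ℝ)))
    (hAc : ∀ ⦃f h : X → ℝ⦄ (c : ℝ), A f → A h → A (fun x => f x + c * h x))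
    {χ : X → ℝ} (hχ : A χ) : A (fun x => 1 - χ x) := by
  have h := hAc (-1) hA1 hχ
  have e : (fun x => (1 : ℝ) + -1 * χ x) = fun x => 1 - χ x := by funext x; ring
  rw [e] at h
  exact h

/-- **Variance of an indicator**: `∫ (χ − a)² w = (1 − a) ∫ χ w` for a `0/1`-valued `χ` with
`a ∫ w = ∫ χ w`. -/
theorem indicator_var_eq (hA1 : A (fun _ => (1 : ℝ)))
    (hAi : ∀ ⦃f h : X → ℝ⦄, A f → A h → Integrable (fun x => f x * h x * w x) μ)
    {χ : X → ℝ} (hχ : A χ) (h01 : ∀ x, χ x = 0 ∨ χ x = 1) {a : ℝ}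
    (ha : a * ∫ x, w x ∂μ = ∫ x, χ x * w x ∂μ) :
    ∫ x, (χ x - a) ^ 2 * w x ∂μ = (1 - a) * ∫ x, χ x * w x ∂μ := by
  have iχ : Integrable (fun x => χ x * w x) μ := by
    have h := hAi hχ hA1
    exact h.congr (Eventually.of_forall fun x => by simp only [mul_one])
  have iw : Integrable (fun x => w x) μ := by
    have h := hAi hA1 hA1
    exact h.congr (Eventually.of_forall fun x => by simp only [mul_one, one_mul])
  have hχsq : ∀ x, χ x ^ 2 = χ x := fun x => by
    rcases h01 x with h | h <;> rw [h] <;> norm_num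
  have e : ∀ x, (χ x - a) ^ 2 * w x = (1 - 2 * a) * (χ x * w x) + a ^ 2 * w x := by
    intro x
    rw [show (χ x - a) ^ 2 = χ x ^ 2 - 2 * a * χ x + a ^ 2 by ring, hχsq x]
    ring
  simp_rw [e]
  rw [integral_add (iχ.const_mul _) (iw.const_mul _), integral_const_mul, integral_const_mul]
  have h2 : a ^ 2 * (∫ x, w x ∂μ) = a * ∫ x, χ x * w x ∂μ := by rw [sq, mul_assoc, ha]
  linarith

/-- **The Dirichlet form of a shifted indicator**: `∫ g² w − ∫ g (K g) w = ∫ χ · K[1 − χ] · w` for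
`g = χ − c`, `χ ∈ A` with values in `{0, 1}` (any constant `c`). -/
theorem dirichlet_indicator_eq (hA1 : A (fun _ => (1 : ℝ)))
    (hAi : ∀ ⦃f h : X → ℝ⦄, A f → A h → Integrable (fun x => f x * h x * w x) μ)
    (hAc : ∀ ⦃f h : X → ℝ⦄ (c : ℝ), A f → A h → A (fun x => f x + c * h x))
    (hAK : ∀ ⦃f : X → ℝ⦄, A f → A (K f))
    (hlin : ∀ ⦃f h : X → ℝ⦄ (c : ℝ), A f → A h →
      ∀ x, K (fun s => f s + c * h s) x = K f x + c * K h x)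
    (hsymm : ∀ ⦃f h : X → ℝ⦄, A f → A h →
      ∫ x, K f x * h x * w x ∂μ = ∫ x, f x * K h x * w x ∂μ)
    (hunit : ∀ x, K (fun _ => (1 : ℝ)) x = 1)
    {χ : X → ℝ} (hχ : A χ) (h01 : ∀ x, χ x = 0 ∨ χ x = 1) (c : ℝ) :
    (∫ x, (χ x - c) ^ 2 * w x ∂μ) - ∫ x, (χ x - c) * K (fun y => χ y - c) x * w x ∂μ
      = ∫ x, χ x * K (fun y => 1 - χ y) x * w x ∂μ := by
  have hg : A (fun x => χ x - c) := sub_const_mem hA1 hAc hχ c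
  have hKχ : A (K χ) := hAK hχ
  -- `K(χ − c) = Kχ − c`, `K(1 − χ) = 1 − Kχ`
  have hKg : ∀ x, K (fun y => χ y - c) x = K χ x - c := by
    intro x
    have h := hlin (-c) hχ hA1 x
    have e : (fun s => χ s + -c * (1 : ℝ)) = fun y => χ y - c := by funext s; ring
    rw [e] at h
    rw [h, hunit]
    ring
  have hK1χ : ∀ x, K (fun y => 1 - χ y) x = 1 - K χ x := by
    intro x
    have h := hlin (-1) hA1 hχ x
    have e : (fun s => (1 : ℝ) + -1 * χ s) = fun y => 1 - χ y := by funext s; ring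
    rw [e] at h
    rw [h, hunit]
    ring
  have hKint : ∫ x, K χ x * w x ∂μ = ∫ x, χ x * w x ∂μ := integral_op_mul_weight hA1 hsymm hunit hχ
  have iχ : Integrable (fun x => χ x * w x) μ := by
    have h := hAi hχ hA1
    exact h.congr (Eventually.of_forall fun x => by simp only [mul_one])
  have iKχ : Integrable (fun x => K χ x * w x) μ := by
    have h := hAi hKχ hA1
    exact h.congr (Eventually.of_forall fun x => by simp only [mul_one])
  have iχKχ : Integrable (fun x => χ x * K χ x * w x) μ := hAi hχ hKχ
  have hχsq : ∀ x, χ x ^ 2 = χ x := fun x => by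
    rcases h01 x with h | h <;> rw [h] <;> norm_num
  have iA : Integrable (fun x => (χ x - c) ^ 2 * w x) μ := by
    have h := hAi hg hg
    exact h.congr (Eventually.of_forall fun x => by simp only [sq])
  have iB : Integrable (fun x => (χ x - c) * K (fun y => χ y - c) x * w x) μ := hAi hg (hAK hg)
  have iX : Integrable (fun x => χ x * w x - χ x * K χ x * w x) μ := iχ.sub' iχKχ
  have iY : Integrable (fun x => c * (χ x * w x - K χ x * w x)) μ := (iχ.sub' iKχ).const_mul c
  have hY : ∫ x, c * (χ x * w x - K χ x * w x) ∂μ = 0 := by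
    rw [integral_const_mul, integral_sub iχ iKχ, hKint, sub_self, mul_zero]
  rw [← integral_sub iA iB]
  have e : ∀ x, (χ x - c) ^ 2 * w x - (χ x - c) * K (fun y => χ y - c) x * w x
      = (χ x * w x - χ x * K χ x * w x) - c * (χ x * w x - K χ x * w x) := by
    intro x
    rw [hKg x, show (χ x - c) ^ 2 = χ x ^ 2 - 2 * c * χ x + c ^ 2 by ring, hχsq x]
    ring
  have e3 : ∀ x, χ x * K (fun y => 1 - χ y) x * w x = χ x * w x - χ x * K χ x * w x := by
    intro x
    rw [hK1χ x]
    ring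
  simp_rw [e, e3]
  rw [integral_sub iX iY, hY, sub_zero]

/-- **A STICKY SET BOUNDS THE DIRICHLET FORM**: if `χ ∈ A` is `0/1`-valued and from every state with
`χ = 1` the set is left with probability at most `ε` (`K[1 − χ](x) ≤ ε` wherever `χ x = 1`), then for
every constant `c`: `∫ (χ − c)² w − ∫ (χ − c) K(χ − c) w ≤ ε ∫ χ w`. -/
theorem dirichlet_indicator_le_of_sticky (hw0 : ∀ x, 0 ≤ w x) (hA1 : A (fun _ => (1 : ℝ)))
    (hAi : ∀ ⦃f h : X → ℝ⦄, A f → A h → Integrable (fun x => f x * h x * w x) μ)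
    (hAc : ∀ ⦃f h : X → ℝ⦄ (c : ℝ), A f → A h → A (fun x => f x + c * h x))
    (hAK : ∀ ⦃f : X → ℝ⦄, A f → A (K f))
    (hlin : ∀ ⦃f h : X → ℝ⦄ (c : ℝ), A f → A h →
      ∀ x, K (fun s => f s + c * h s) x = K f x + c * K h x)
    (hsymm : ∀ ⦃f h : X → ℝ⦄, A f → A h →
      ∫ x, K f x * h x * w x ∂μ = ∫ x, f x * K h x * w x ∂μ)
    (hunit : ∀ x, K (fun _ => (1 : ℝ)) x = 1)
    {χ : X → ℝ} (hχ : A χ) (h01 : ∀ x, χ x = 0 ∨ χ x = 1) {ε : ℝ}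
    (hsticky : ∀ x, χ x = 1 → K (fun y => 1 - χ y) x ≤ ε) (c : ℝ) :
    (∫ x, (χ x - c) ^ 2 * w x ∂μ) - ∫ x, (χ x - c) * K (fun y => χ y - c) x * w x ∂μ
      ≤ ε * ∫ x, χ x * w x ∂μ := by
  rw [dirichlet_indicator_eq hA1 hAi hAc hAK hlin hsymm hunit hχ h01 c, ← integral_const_mul]
  have iχ : Integrable (fun x => χ x * w x) μ := by
    have h := hAi hχ hA1
    exact h.congr (Eventually.of_forall fun x => by simp only [mul_one])
  have iR : Integrable (fun x => χ x * K (fun y => 1 - χ y) x * w x) μ :=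
    hAi hχ (hAK (one_sub_mem hA1 hAc hχ))
  refine integral_mono iR (iχ.const_mul ε) fun x => ?_
  show χ x * K (fun y => 1 - χ y) x * w x ≤ ε * (χ x * w x)
  rcases h01 x with h0 | h1
  · simp only [h0, zero_mul, mul_zero, le_refl]
  · rw [h1, one_mul, one_mul]
    exact mul_le_mul_of_nonneg_right (hsticky x h1) (hw0 x)

/-- **A STICKY SET OF MASS AT MOST ONE HALF KILLS THE GAP**: under the hypotheses of
`dirichlet_indicator_le_of_sticky`, with `a ∫ w = ∫ χ w`, `0 < ∫ χ w`, `a ≤ ½` and `ε ≥ 0`, the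
centred indicator `g = χ − a` has lag-one autocorrelation `∫ g (Kg) w / ∫ g² w ≥ 1 − 2ε`. -/
theorem autocorr_ge_of_sticky (hw0 : ∀ x, 0 ≤ w x) (hA1 : A (fun _ => (1 : ℝ)))
    (hAi : ∀ ⦃f h : X → ℝ⦄, A f → A h → Integrable (fun x => f x * h x * w x) μ)
    (hAc : ∀ ⦃f h : X → ℝ⦄ (c : ℝ), A f → A h → A (fun x => f x + c * h x))
    (hAK : ∀ ⦃f : X → ℝ⦄, A f → A (K f))
    (hlin : ∀ ⦃f h : X → ℝ⦄ (c : ℝ), A f → A h →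
      ∀ x, K (fun s => f s + c * h s) x = K f x + c * K h x)
    (hsymm : ∀ ⦃f h : X → ℝ⦄, A f → A h →
      ∫ x, K f x * h x * w x ∂μ = ∫ x, f x * K h x * w x ∂μ)
    (hunit : ∀ x, K (fun _ => (1 : ℝ)) x = 1)
    {χ : X → ℝ} (hχ : A χ) (h01 : ∀ x, χ x = 0 ∨ χ x = 1) {ε : ℝ} (hε : 0 ≤ ε)
    (hsticky : ∀ x, χ x = 1 → K (fun y => 1 - χ y) x ≤ ε) {a : ℝ}
    (ha : a * ∫ x, w x ∂μ = ∫ x, χ x * w x ∂μ) (hpos : 0 < ∫ x, χ x * w x ∂μ) (hahalf : a ≤ 1 / 2) :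
    1 - 2 * ε ≤ (∫ x, (χ x - a) * K (fun y => χ y - a) x * w x ∂μ)
        / ∫ x, (χ x - a) ^ 2 * w x ∂μ := by
  have hdir := dirichlet_indicator_le_of_sticky hw0 hA1 hAi hAc hAK hlin hsymm hunit hχ h01 hsticky a
  have hP := indicator_var_eq hA1 hAi hχ h01 ha
  have hPpos : 0 < (1 - a) * ∫ x, χ x * w x ∂μ := mul_pos (by linarith) hpos
  rw [hP] at hdir ⊢
  rw [le_div_iff₀ hPpos]
  have h1a : 1 / 2 ≤ 1 - a := by linarith
  nlinarith [mul_nonneg hε hpos.le]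

end RevOp

end Summit.Ventures.LatticeQCDFlow.Exactness
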